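import Mathlib
import HarnessLib

/-!
# The pairing count behind the fourth moment of a Gaussian permanent

Pure combinatorics used in the proof of Lemma 8.8 of Aaronson–Arkhipov, *The computational
complexity of linear optics*, Theory of Computing 9 (2013) 143–252 (`𝔼 |Per X|⁴ = (n+1)(n!)²`
for `X ∼ 𝒩(0,1)_ℂ^{n×n}`). After integrating out the Gaussian rows with the Wick rule
`𝔼[x_a x_b conj(x_c) conj(x_d)] = [a=c][b=d] + [a=d][b=c]`, the fourth moment equals the number

`T(n) = ∑_{σ,τ,α,β ∈ S_n} ∏_i ( [σ i = α i ∧ τ i = β i] + [σ i = β i ∧ τ i = α i] )`,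

and this file proves `T(n) = (n+1) · (n!)²` (`fourthMomentPairingCount`).

Proof (a re-organisation of the printed argument, pp. 225–227, which counts via `2^{cyc ξ}` and
Proposition 8.7): expanding the product over subsets `t ⊆ [n]` forces `α` (resp. `β`) to be the
map `t.piecewise σ τ` agreeing with `σ` on `t` and `τ` off `t` (resp. `t.piecewise τ σ`); after the
substitution `τ = σ ξ` both maps are bijections iff `ξ` stabilises `t`, and there are
`|t|! (n-|t|)!` such `ξ` (`DomMulAct.stabilizer_card`), whence
`T(n) = n! ∑_t |t|! (n-|t|)! = n! ∑_k (n choose k) k! (n-k)! = (n+1) (n!)²`.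
-/

namespace Literature.Computability.QuantumComplexity

namespace PermanentPairing

open Finset

variable {ι : Type*} [Fintype ι] [DecidableEq ι]

/-- The number of permutations whose underlying map is a given `f` is `[f bijective]`.
[folklore] -/
theorem sum_perm_ite_coe_eq (f : ι → ι) :
    ∑ α : Equiv.Perm ι, (if ⇑α = f then 1 else 0 : ℕ) = if f.Bijective then 1 else 0 := by
  rw [Finset.sum_boole, Nat.cast_id]
  split_ifs with hf
  · rw [Finset.card_eq_one]
    refine ⟨Equiv.ofBijective f hf, ?_⟩
    ext α
    simp only [Finset.mem_filter, Finset.mem_univ, true_and, Finset.mem_singleton]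
    constructor
    · intro h
      ext i
      rw [Equiv.ofBijective_apply, ← h]
    · rintro rfl
      rfl
  · rw [Finset.card_eq_zero, Finset.filter_eq_empty_iff]
    intro α _ h
    exact hf (h ▸ α.bijective)

/-- For a permutation `ξ`, the map "`ξ` on `t`, identity off `t`" (Mathlib's
`Finset.piecewise`) is a bijection iff `ξ` stabilises `t`. [folklore] -/
theorem bijective_piecewise_id_iff (t : Finset ι) (ξ : Equiv.Perm ι) :
    (t.piecewise ⇑ξ id).Bijective ↔ ∀ i, ξ i ∈ t ↔ i ∈ t := by
  constructor
  · intro hb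
    have h1 : ∀ i ∈ t, ξ i ∈ t := by
      intro i hi
      by_contra hξ
      have heq : t.piecewise ⇑ξ id i = t.piecewise ⇑ξ id (ξ i) := by
        simp [Finset.piecewise, hi, hξ]
      have := hb.1 heq
      rw [← this] at hξ
      exact hξ hi
    have h2 : t.image ξ = t :=
      Finset.eq_of_subset_of_card_le (Finset.image_subset_iff.mpr h1)
        (by rw [Finset.card_image_of_injective _ ξ.injective])
    intro i
    refine ⟨fun hξi => ?_, h1 i⟩
    rw [← h2] at hξi
    obtain ⟨j, hj, hji⟩ := Finset.mem_image.mp hξi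
    rwa [← ξ.injective hji]
  · intro h
    refine Finite.injective_iff_bijective.mp fun i j hij => ?_
    simp only [Finset.piecewise, id] at hij
    by_cases hi : i ∈ t <;> by_cases hj : j ∈ t
    · rw [if_pos hi, if_pos hj] at hij
      exact ξ.injective hij
    · rw [if_pos hi, if_neg hj] at hij
      have : ξ i ∈ t := (h i).mpr hi
      rw [hij] at this
      exact absurd this hj
    · rw [if_neg hi, if_pos hj] at hij
      have : ξ j ∈ t := (h j).mpr hj
      rw [← hij] at this
      exact absurd this hi
    · rw [if_neg hi, if_neg hj] at hij
      exact hij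

/-- For a permutation `ξ`, the map "identity on `t`, `ξ` off `t`" is a bijection iff `ξ`
stabilises `t`. [folklore] -/
theorem bijective_piecewise_id_iff' (t : Finset ι) (ξ : Equiv.Perm ι) :
    (t.piecewise id ⇑ξ).Bijective ↔ ∀ i, ξ i ∈ t ↔ i ∈ t := by
  rw [← Finset.piecewise_compl, bijective_piecewise_id_iff]
  simp only [Finset.mem_compl, not_iff_not]

/-- The number of permutations of a finite type stabilising a finset `t` is
`|t|! · (|ι| - |t|)!` (a special case of `DomMulAct.stabilizer_card`). [folklore] -/
theorem card_perm_stabilising (t : Finset ι) :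
    ((Finset.univ : Finset (Equiv.Perm ι)).filter (fun ξ => ∀ i, ξ i ∈ t ↔ i ∈ t)).card
      = t.card.factorial * (Fintype.card ι - t.card).factorial := by
  let f : ι → Bool := fun i => decide (i ∈ t)
  have key := DomMulAct.stabilizer_card f
  have h1 : ∀ g : Equiv.Perm ι, f ∘ ⇑g = f ↔ ∀ i, g i ∈ t ↔ i ∈ t := by
    intro g
    simp only [funext_iff, Function.comp_apply, f, decide_eq_decide]
  rw [Fintype.card_subtype] at key
  simp_rw [h1] at key
  rw [key, Fintype.prod_bool]
  have ht : Fintype.card {a // f a = true} = t.card := by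
    rw [Fintype.card_subtype]
    congr 1
    ext a
    simp [f]
  have hf : Fintype.card {a // f a = false} = Fintype.card ι - t.card := by
    rw [Fintype.card_subtype, ← ht, Fintype.card_subtype, ← Finset.card_compl]
    congr 1
    ext a
    simp [f]
  rw [ht, hf]

omit [Fintype ι] in
/-- `t.piecewise σ (σ ξ) = σ ∘ t.piecewise id ξ`. [folklore] -/
theorem piecewise_mul_right (t : Finset ι) (σ ξ : Equiv.Perm ι) :
    t.piecewise ⇑σ ⇑(σ * ξ) = ⇑σ ∘ t.piecewise id ⇑ξ := by
  funext i
  by_cases hi : i ∈ t <;> simp [Finset.piecewise, hi, Equiv.Perm.mul_apply]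

omit [Fintype ι] in
/-- `t.piecewise (σ ξ) σ = σ ∘ t.piecewise ξ id`. [folklore] -/
theorem piecewise_mul_left (t : Finset ι) (σ ξ : Equiv.Perm ι) :
    t.piecewise ⇑(σ * ξ) ⇑σ = ⇑σ ∘ t.piecewise ⇑ξ id := by
  funext i
  by_cases hi : i ∈ t <;> simp [Finset.piecewise, hi, Equiv.Perm.mul_apply]

/-- Expanding `∏_i ([σ i = α i ∧ τ i = β i] + [σ i = β i ∧ τ i = α i])` over subsets: the term
indexed by `t` is the indicator that `α = t.piecewise σ τ` and `β = t.piecewise τ σ`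
(`Finset.piecewise t σ τ` is `σ` on `t` and `τ` off `t`). [folklore] -/
theorem prod_indicator_pair_eq (t : Finset ι) (σ τ α β : ι → ι) :
    ((∏ i ∈ t, (if σ i = α i ∧ τ i = β i then 1 else 0 : ℕ)) *
        ∏ i ∈ Finset.univ \ t, (if σ i = β i ∧ τ i = α i then 1 else 0 : ℕ)) =
      if α = t.piecewise σ τ ∧ β = t.piecewise τ σ then 1 else 0 := by
  rw [Finset.prod_boole, Finset.prod_boole, ite_zero_mul_ite_zero, one_mul]
  have hiff : ((∀ i ∈ t, σ i = α i ∧ τ i = β i) ∧ ∀ i ∈ Finset.univ \ t, σ i = β i ∧ τ i = α i) ↔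
      (α = t.piecewise σ τ ∧ β = t.piecewise τ σ) := by
    constructor
    · rintro ⟨hin, hout⟩
      constructor
      · funext i
        by_cases hi : i ∈ t
        · simp [Finset.piecewise, hi, (hin i hi).1]
        · simp [Finset.piecewise, hi, (hout i (by simp [hi])).2]
      · funext i
        by_cases hi : i ∈ t
        · simp [Finset.piecewise, hi, (hin i hi).2]
        · simp [Finset.piecewise, hi, (hout i (by simp [hi])).1]
    · rintro ⟨rfl, rfl⟩
      constructor
      · intro i hi
        simp [Finset.piecewise, hi]
      · intro i hi
        simp only [Finset.mem_sdiff, Finset.mem_univ, true_and] at hi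
        simp [Finset.piecewise, hi]
  simp only [hiff]

/-- **The pairing count** (the combinatorial content of Aaronson–Arkhipov 2013, Lemma 8.8,
pp. 225–227): `∑_{σ,τ,α,β ∈ S_n} ∏_i ([σ i = α i ∧ τ i = β i] + [σ i = β i ∧ τ i = α i])
= (n+1) · (n!)²`. [cite: AaronsonArkhipovToC2013, Lemma 8.8 p. 225 (proof pp. 225–227)] -/
theorem fourthMomentPairingCount (n : ℕ) :
    (∑ σ : Equiv.Perm (Fin n), ∑ τ : Equiv.Perm (Fin n),
        ∑ α : Equiv.Perm (Fin n), ∑ β : Equiv.Perm (Fin n),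
          ∏ i, ((if σ i = α i ∧ τ i = β i then 1 else 0 : ℕ) +
            (if σ i = β i ∧ τ i = α i then 1 else 0 : ℕ))) =
      (n + 1) * n.factorial ^ 2 := by
  -- Step 1: for fixed `σ, τ`, sum out `α, β`.
  have step1 : ∀ σ τ : Equiv.Perm (Fin n),
      (∑ α : Equiv.Perm (Fin n), ∑ β : Equiv.Perm (Fin n),
          ∏ i, ((if σ i = α i ∧ τ i = β i then 1 else 0 : ℕ) +
            (if σ i = β i ∧ τ i = α i then 1 else 0 : ℕ))) =
        ∑ t : Finset (Fin n), (if (t.piecewise ⇑σ ⇑τ).Bijective then 1 else 0 : ℕ) *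
          (if (t.piecewise ⇑τ ⇑σ).Bijective then 1 else 0 : ℕ) := by
    intro σ τ
    calc (∑ α : Equiv.Perm (Fin n), ∑ β : Equiv.Perm (Fin n),
          ∏ i, ((if σ i = α i ∧ τ i = β i then 1 else 0 : ℕ) +
            (if σ i = β i ∧ τ i = α i then 1 else 0 : ℕ)))
        = ∑ α : Equiv.Perm (Fin n), ∑ β : Equiv.Perm (Fin n), ∑ t : Finset (Fin n),
            (if ⇑α = t.piecewise ⇑σ ⇑τ ∧ ⇑β = t.piecewise ⇑τ ⇑σ then 1 else 0 : ℕ) := by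
          refine Finset.sum_congr rfl fun α _ => Finset.sum_congr rfl fun β _ => ?_
          rw [Finset.prod_add, Finset.powerset_univ]
          exact Finset.sum_congr rfl fun t _ => prod_indicator_pair_eq t _ _ _ _
      _ = ∑ t : Finset (Fin n), ∑ α : Equiv.Perm (Fin n), ∑ β : Equiv.Perm (Fin n),
            (if ⇑α = t.piecewise ⇑σ ⇑τ ∧ ⇑β = t.piecewise ⇑τ ⇑σ then 1 else 0 : ℕ) := by
          exact Finset.sum_comm_cycle
      _ = ∑ t : Finset (Fin n), (∑ α : Equiv.Perm (Fin n),
            (if ⇑α = t.piecewise ⇑σ ⇑τ then 1 else 0 : ℕ)) *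
              ∑ β : Equiv.Perm (Fin n), (if ⇑β = t.piecewise ⇑τ ⇑σ then 1 else 0 : ℕ) := by
          refine Finset.sum_congr rfl fun t _ => ?_
          rw [Finset.sum_mul_sum]
          refine Finset.sum_congr rfl fun α _ => Finset.sum_congr rfl fun β _ => ?_
          rw [ite_zero_mul_ite_zero, one_mul]
      _ = _ := by simp_rw [sum_perm_ite_coe_eq]
  -- Step 2: substitute `τ = σ ξ`; both bijectivity conditions become "`ξ` stabilises `t`".
  have step2 : ∀ (t : Finset (Fin n)) (σ : Equiv.Perm (Fin n)),
      (∑ τ : Equiv.Perm (Fin n), (if (t.piecewise ⇑σ ⇑τ).Bijective then 1 else 0 : ℕ) *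
          (if (t.piecewise ⇑τ ⇑σ).Bijective then 1 else 0 : ℕ)) =
        ((Finset.univ : Finset (Equiv.Perm (Fin n))).filter
          (fun ξ => ∀ i, ξ i ∈ t ↔ i ∈ t)).card := by
    intro t σ
    rw [← _root_.Equiv.sum_comp (Equiv.mulLeft σ)]
    simp only [Equiv.coe_mulLeft, piecewise_mul_right, piecewise_mul_left, Equiv.comp_bijective,
      bijective_piecewise_id_iff, bijective_piecewise_id_iff', ite_zero_mul_ite_zero, one_mul,
      and_self,
      Finset.sum_boole, Nat.cast_id]
  -- Step 3: assemble.
  calc (∑ σ : Equiv.Perm (Fin n), ∑ τ : Equiv.Perm (Fin n),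
        ∑ α : Equiv.Perm (Fin n), ∑ β : Equiv.Perm (Fin n),
          ∏ i, ((if σ i = α i ∧ τ i = β i then 1 else 0 : ℕ) +
            (if σ i = β i ∧ τ i = α i then 1 else 0 : ℕ)))
      = ∑ σ : Equiv.Perm (Fin n), ∑ τ : Equiv.Perm (Fin n), ∑ t : Finset (Fin n),
          (if (t.piecewise ⇑σ ⇑τ).Bijective then 1 else 0 : ℕ) *
            (if (t.piecewise ⇑τ ⇑σ).Bijective then 1 else 0 : ℕ) := by
        simp_rw [step1]
    _ = ∑ t : Finset (Fin n), ∑ σ : Equiv.Perm (Fin n), ∑ τ : Equiv.Perm (Fin n),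
          (if (t.piecewise ⇑σ ⇑τ).Bijective then 1 else 0 : ℕ) *
            (if (t.piecewise ⇑τ ⇑σ).Bijective then 1 else 0 : ℕ) := by
        exact Finset.sum_comm_cycle
    _ = ∑ t : Finset (Fin n), n.factorial * (t.card.factorial * (n - t.card).factorial) := by
        refine Finset.sum_congr rfl fun t _ => ?_
        have hc := card_perm_stabilising (ι := Fin n) t
        rw [Fintype.card_fin] at hc
        rw [Finset.sum_congr rfl fun σ _ => step2 t σ, Finset.sum_const, Finset.card_univ,
          Fintype.card_perm, Fintype.card_fin, smul_eq_mul]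
        congr 1
        convert hc using 2
        ext ξ
        simp only [Finset.mem_filter]
    _ = (n + 1) * n.factorial ^ 2 := by
        rw [← Finset.mul_sum, ← Finset.powerset_univ,
          Finset.sum_powerset_apply_card (fun k => k.factorial * (n - k).factorial)]
        simp only [Finset.card_univ, Fintype.card_fin, smul_eq_mul]
        rw [Finset.sum_congr rfl (fun k hk => by
          rw [← mul_assoc, Nat.choose_mul_factorial_mul_factorial
            (Nat.lt_succ_iff.mp (Finset.mem_range.mp hk))]),
          Finset.sum_const, Finset.card_range, smul_eq_mul]
        ring

end PermanentPairing

end Literature.Computability.QuantumComplexity
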